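import Literature.MathematicalPhysics.QuantumFieldTheory.Balaban1983to89.Node00.TStepOfRecord
import Literature.MathematicalPhysics.QuantumFieldTheory.Balaban1983to89.Node00.BackgroundActionOfRecord
import Literature.MathematicalPhysics.QuantumFieldTheory.Balaban1983to89.B14Eq16FaddeevPopov
import Literature.MathematicalPhysics.QuantumFieldTheory.Balaban1983to89.B12FaddeevPopov016TwoLevel
import Literature.MathematicalPhysics.QuantumFieldTheory.Balaban1983to89.T4TreeGaugeFixing

/-!
# NODE 00 — GAUGE FIXING UNDER THE δ-FUNCTION OF THE ONE-STEP TRANSPORT: the Faddeev–Popov weight of [III] (1.5)⇒(1.6) ∕ p. 265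
# and the hard tree gauge, as A.E. LAWS about def-T's value `(†) = ∫dU δ(ŪV⁻¹)[…]` (kernel transport along the averaging of record)

HEADER — WORK-UNIT METADATA.  Cell `pub-ymgap`, YM-PLAN Track A (HUMAN RULING D-0062), R134 fan-out seat `pub-ymgap-dag-n11-e` (g22) on node N11
[B14], strategy s3; route `BalabanUVNodes`, item K1⁷ `StabilityBAtRecordR13SepCoPH` = stmt-QuantumFields-20542 (helper, `--kind proof --supports 20542`,
count-neutral).  [I] = [Balaban1987RG1] (CMP 109), [III] = [Balaban1988Convergent] (CMP 119).  Over, BY NAME and unmodified: p28's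
`B14Eq16FaddeevPopov` (§1 `integral_eq_integral_weight_mul` = THE FADDEEV–POPOV PROCEDURE FOR A PARTIAL GAUGE FIXING as a PAIRING identity
`∫dU F = ∫dU fpW·F`, §2 `weight_eq`), r09's `B12FaddeevPopov016` (`FineGauge`, `FineGaugeInvariant`, `fpIntegrand`) and `…TwoLevel`
(`measurable_holTo`, `zNorm_specialUnitaryGroup_pos`), gen 16's `T4TreeGaugeFixing` (`TreeOrder`-peeling `lintegral_eq_lintegral_fixTo_of_treeOrder`, the
free-bond carrier `Free T`, `glue`, `freeMeasure`, `map_fixTo_eq_map_glue`), the disintegration API `T4AveragingDisintegration` (`kernelTransport`,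
`integral_kernelTransport_mul`, `integrable_kernelTransport`, `ae_eq_of_forall_integral_mul_eq`), node00-def-T's `Node00.TStepOfRecord` (`transportOfRecord`)
and node00's `contourOfRecord` ((0.11) with Federbush's inner mean).

WHY.  def-T's FILE 1 defines the level-`(k+1)` slot by the δ-function integral (3.1) read as the ONE-STEP DISINTEGRATION KERNEL TRANSPORT along
`avOfRecord` — «before any rewriting … Everything (3.10)–(3.25) does to a term — background field, GAUGE CHANGES OF VARIABLES, conditional Gaussian
integration — is then a LAW about the value (†)» (its header).  The first such law print applies is the GAUGE FIXING: [III] p. 265 L.10–12 «In the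
complement (P″_{k+1} ∪ Z_k^{∼5})ᶜ we introduce the axial gauge fixing as in (1.5), with V_k, ε_k, g_k instead of U, ε₀, g₀ … We get an expansion of
the form (1.6)», i.e. p. 247 «We insert it [(1.5)] under the integral, and we apply the Faddeev-Popov procedure» — UNDER `∫dU δ(ŪV⁻¹)`, legitimately
because «the δ-functions … are invariant under the gauge transformations u satisfying u(y) = 1 for y ∈ T⁽¹⁾» ([I] p. 254; the tree's
`B14Eq16FaddeevPopov.avg_gaugeAct_of_fineGauge`).  In the tree (1.5)⇒(1.6) is p28's PAIRING identity `∫dU F(U) = ∫dU fpW(U)·F(U)` for fine-gauge-invariant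
`F`; the tree gauge of `T4TreeGaugeFixing` likewise.  THIS FILE moves both UNDER THE δ-FUNCTION, i.e. states them as `dV`-a.e. identities between KERNEL
TRANSPORTS — the currency of def-T's (†), of dag-n11-d's (O3′)-junction `…GenOpJunction` (whose right side, 11a's `genOp`, carries «gauge-fixing factors»
in `ζ`, `TkOfRecord` header) and of every chart seat of the (B4)∕(S-α) layer.  The mechanism is ONE principle (§1): two integrable fine densities — on
possibly DIFFERENT fine carriers over the same coarse reference — with equal pairings against every bounded measurable `f ∘ Ū` have a.e.-equal kernel
transports (`integral_kernelTransport_mul` + a.e. uniqueness).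

WHAT THIS FILE PROVES (22 theorems + 1 private range lemma; 0 `def`, 0 `sorry`, standard axioms).
§1 THE PRINCIPLE (generic measurable spaces): ★ `kernelTransport_ae_eq_of_forall_integral_mul_comp_eq` (two fine carriers), `kernelTransport_ae_eq_of_forall_integral_mul_comp_eq'`
   (one carrier).
§2 SOFT (FADDEEV–POPOV) GAUGE FIXING UNDER δ(ŪV⁻¹) (generic `GaugeGroup G` with Haar data, any level `j` of the standing range, any `cd : ContourData`, any finset
   `Y` of centres, `α > 0`, `z ≠ 0`; `avg` measurable and invariant under the fine gauge group; `ρ` fine-gauge-invariant and integrable):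
   `fineGauge_siteTransf_of_forall_ne_emb` · `fineGaugeInvariant_mul_comp_avg` (+ `_averaging`) · `integral_fpWeight_mul_mul_comp_avg_eq` (p28 §1 at `F = ρ·(f∘Ū)`) ·
   ★★ `kernelTransport_fpWeight_mul_ae_eq` (`transportK Ū (fpW·ρ) =ᵐ[dV] transportK Ū ρ`, needs `HaarAC`) · ★ `isRT_fpWeight_mul_iff` (`Setup.IsRT` currency, NO `HaarAC`) ·
   `kernelTransport_chiAx_mul_expGaugeFix_mul_ae_eq` (p28's `weight_eq` shape `χ_{Ax}(Y)·exp[−(1∕α)𝐆(Y,·) − (L^d − 1)|Y| log z]`, `z > 0`).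
§3 HARD (TREE) GAUGE FIXING UNDER δ(ŪV⁻¹) (a bond set `T` with a `TreeOrder T v r` whose fresh ends `v b` are never block centres `emb y`; `ρ` fine-gauge-invariant):
   `map_eq_map_fixTo_of_fineGaugeInvariant` (law form for any measurable `Φ(U) = φ(ρ U, Ū U)`-type observable invariant under the fresh-end transformations) ·
   `integral_mul_comp_avg_eq_integral_fixTo` · `integral_mul_comp_avg_eq_integral_freeMeasure_glue` · `map_avg_eq_map_avg_glue_freeMeasure` ·
   `integrable_comp_glue_freeMeasure` · ★★ `kernelTransport_ae_eq_kernelTransport_freeMeasure_glue`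
   (`transportK Ū ρ =ᵐ[dV] kernelTransport (∏_{b∉T} dU(b)) dV (Ū ∘ glue T U₀) (ρ ∘ glue T U₀)` — the fibre integral runs over the FREE bonds only).
§4 AT THE RECORD (`G = SU(N)`, torus `F.P K`, step `k < K`, `cd := contourOfRecord F N K k`, `ε₀ > 0` so `z > 0`): `avOfRecord_gaugeAct_of_fineGauge` ·
   `measurable_holTo_contourOfRecord` · ★★★ `transportOfRecord_fpWeight_mul_ae_eq` ·
   ★ `isRT_avOfRecord_fpWeight_mul_iff` · `transportOfRecord_chiAx_mul_exp_gaugeFixFn_mul_ae_eq` (at `Y = univ` the exponent reads node00's `gfOfRecord`: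
   `transportOfRecord_chiAx_mul_exp_gfOfRecord_mul_ae_eq`) · ★★ `transportOfRecord_ae_eq_kernelTransport_freeMeasure_glue`.

NOT IN THIS FILE: which set `Y` of centres ∕ which tree print fixes at step `k` ((P″_{k+1} ∪ Z_k^{∼5})ᶜ, p. 265 — def-R∕def-T's regions), the redundancy
«χ_{Ax} = 1 on Ω^∼_{k+1}» ((3.6)–(3.9), an ESTIMATE), the resummation into `ζ(Ω_{k+1})` (p. 267), any chart ∕ Jacobian ((B4) concrete half), K0b's re-pin.

HONEST FRAMING.  Helper lane of K1⁷, count-neutral; compositions BY NAME of landed [folklore] ∕ bookkeeping theorems; nothing of Bałaban's ESTIMATES is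
asserted; (B4) ∕ (S-α) ∕ (O3′) NOT closed; N11 NOT discharged; K1⁷ NOT closed; counts unmoved (typed 28∕28 · discharged 5∕27).  One finite four-torus programme
at fixed `ε = L^{−K}`; R4 closes only the conditional finite-𝕋⁴ rung `BalabanLadder.UV` — NOT ℝ⁴, NOT OS, NOT a mass gap, NOT Clay.  No `sorry`, `axiom`, `def`,
`instance`, `notation`.  Sources (SHAPE ∕ bookkeeping only): [III] (1.5)–(1.7) p.247, (3.1) p.264, p.265 L.10–12, p.267 L.12–16; [I] (0.13)–(0.16) pp.254–255.
-/

noncomputable section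

open _root_.MeasureTheory _root_.Function
open scoped ENNReal BigOperators

namespace Literature.MathematicalPhysics.QuantumFieldTheory.Balaban1983to89.Node00

open T4Continuum (T4Family)
open GaugeField (gaugeAct GaugeInvariant)
open T4AveragingDisintegration (kernelTransport transportK integral_kernelTransport_mul integrable_kernelTransport
  ae_eq_of_forall_integral_mul_eq)
open T4FiniteEpsInhabited (HaarAC)
open T4AxialGaugeFixing (siteTransf siteTransf_of_ne TreeOrder)
open T4TreeGaugeFixing (fixTo Free glue freeMeasure restrictFree measurable_fixTo measurable_glue measurable_restrictFree
  lintegral_eq_lintegral_fixTo_of_treeOrder map_fixTo_eq_map_glue fixTo_eq_glue_restrictFree measurePreserving_restrictFree)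
open B12FaddeevPopov016 (FineGauge FineGaugeInvariant fpIntegrand)
open B14Eq16FaddeevPopov (avg_gaugeAct_of_fineGauge integral_eq_integral_weight_mul integrable_weight_mul weight_eq)

/-! ## §1  THE PRINCIPLE: equal pairings against `f ∘ Ū` ⇒ a.e.-equal kernel transports -/

section Principle

variable {α β₁ β₂ : Type*} [MeasurableSpace α] [MeasurableSpace β₁] [MeasurableSpace β₂]
  [StandardBorelSpace β₁] [Nonempty β₁] [StandardBorelSpace β₂] [Nonempty β₂]

/-- ★ **THE PRINCIPLE (two fine carriers).**  Two fine laws `ν₁`, `ν₂` (finite) on two carriers, averaged to the SAME coarse carrier by measurable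
`avg₁`, `avg₂` with `νᵢ.map avgᵢ ≪ μ` (`μ` σ-finite), and two integrable densities `ρ₁`, `ρ₂` with EQUAL PAIRINGS against every bounded measurable test
function of the coarse field, `∫ ρ₁·(f ∘ avg₁) dν₁ = ∫ ρ₂·(f ∘ avg₂) dν₂`: then the two kernel transports agree `μ`-a.e. — every identity print performs
«under the integral `∫dU δ(ŪV⁻¹)`» by a change of the fine variables is an instance (`integral_kernelTransport_mul` twice + a.e. uniqueness
`ae_eq_of_forall_integral_mul_eq`). [cite: Balaban1988Convergent, (3.1) p.264; Balaban1987RG1, (0.13) p.254 (bookkeeping)] -/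
theorem kernelTransport_ae_eq_of_forall_integral_mul_comp_eq
    (ν₁ : Measure β₁) [IsFiniteMeasure ν₁] (ν₂ : Measure β₂) [IsFiniteMeasure ν₂] (μ : Measure α) [SigmaFinite μ]
    {avg₁ : β₁ → α} (h₁ : Measurable avg₁) (hac₁ : ν₁.map avg₁ ≪ μ)
    {avg₂ : β₂ → α} (h₂ : Measurable avg₂) (hac₂ : ν₂.map avg₂ ≪ μ)
    {ρ₁ : β₁ → ℝ} (hρ₁ : Integrable ρ₁ ν₁) {ρ₂ : β₂ → ℝ} (hρ₂ : Integrable ρ₂ ν₂)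
    (h : ∀ f : α → ℝ, Measurable f → (∃ C : ℝ, ∀ V, |f V| ≤ C) →
      ∫ U, ρ₁ U * f (avg₁ U) ∂ν₁ = ∫ U, ρ₂ U * f (avg₂ U) ∂ν₂) :
    kernelTransport ν₁ μ avg₁ ρ₁ =ᵐ[μ] kernelTransport ν₂ μ avg₂ ρ₂ := by
  refine ae_eq_of_forall_integral_mul_eq (integrable_kernelTransport ν₁ μ h₁ hac₁ hρ₁)
    (integrable_kernelTransport ν₂ μ h₂ hac₂ hρ₂) fun f hf hC => ?_
  obtain ⟨C, hC⟩ := hC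
  rw [integral_kernelTransport_mul ν₁ μ h₁ hac₁ hρ₁ hf hC, integral_kernelTransport_mul ν₂ μ h₂ hac₂ hρ₂ hf hC]
  exact h f hf ⟨C, hC⟩

/-- THE PRINCIPLE (one fine carrier): two integrable fine densities with equal pairings against every bounded measurable `f ∘ Ū` have a.e.-equal
kernel transports. [cite: Balaban1988Convergent, (3.1) p.264; Balaban1987RG1, (0.13) p.254 (bookkeeping)] -/
theorem kernelTransport_ae_eq_of_forall_integral_mul_comp_eq'
    (ν : Measure β₁) [IsFiniteMeasure ν] (μ : Measure α) [SigmaFinite μ]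
    {avg : β₁ → α} (havg : Measurable avg) (hac : ν.map avg ≪ μ)
    {ρ₁ ρ₂ : β₁ → ℝ} (hρ₁ : Integrable ρ₁ ν) (hρ₂ : Integrable ρ₂ ν)
    (h : ∀ f : α → ℝ, Measurable f → (∃ C : ℝ, ∀ V, |f V| ≤ C) →
      ∫ U, ρ₁ U * f (avg U) ∂ν = ∫ U, ρ₂ U * f (avg U) ∂ν) :
    kernelTransport ν μ avg ρ₁ =ᵐ[μ] kernelTransport ν μ avg ρ₂ :=
  kernelTransport_ae_eq_of_forall_integral_mul_comp_eq ν ν μ havg hac havg hac hρ₁ hρ₂ h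

end Principle

/-! ## §2  SOFT GAUGE FIXING: the Faddeev–Popov weight of (1.5)⇒(1.6) under `δ(ŪV⁻¹)` -/

section Soft

variable {P : Params} {j : ℕ} {G : Type*} [GaugeGroup G]

/-- A one-site gauge transformation at a site which is NOT a block centre belongs to the fine gauge group «u(y) = 1 for y ∈ T⁽¹⁾».
[cite: Balaban1987RG1, (0.13) p.254 (bookkeeping)] -/
theorem fineGauge_siteTransf_of_forall_ne_emb {x : Site P j} (hx : ∀ y : Site P (j + 1), x ≠ emb y) (g : G) :
    FineGauge (siteTransf x g) :=
  fun y => siteTransf_of_ne (hx y).symm g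

/-- The push-forward integrand `ρ(U)·f(Ū U)` of (0.1)∕(3.1) is FINE-GAUGE INVARIANT when `ρ` is and the averaging is invariant under the fine gauge group
(«the δ-functions … are invariant under the gauge transformations u satisfying u(y) = 1», [I] p. 254).
[cite: Balaban1987RG1, (0.13) p.254; Balaban1988Convergent, (1.6) p.247 (bookkeeping)] -/
theorem fineGaugeInvariant_mul_comp_avg {avg : GaugeField P j G → GaugeField P (j + 1) G}
    (havgInv : ∀ u : GaugeTransf P j G, FineGauge u → ∀ U, avg (gaugeAct u U) = avg U)
    {ρ : Density P j G} (hρ : FineGaugeInvariant ρ) (f : GaugeField P (j + 1) G → ℝ) :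
    FineGaugeInvariant (fun U => ρ U * f (avg U)) := by
  intro u hu U
  simp only [hρ u hu U, havgInv u hu U]

/-- For an `Averaging` of the standing range the invariance hypothesis `havgInv` is the tree's `avg_gaugeAct_of_fineGauge`.
[cite: Balaban1988Convergent, (1.6) p.247 (bookkeeping)] -/
theorem fineGaugeInvariant_mul_comp_averaging (hj : j + 1 ≤ P.m + P.K) (av : Averaging P j G)
    {ρ : Density P j G} (hρ : FineGaugeInvariant ρ) (f : GaugeField P (j + 1) G → ℝ) :
    FineGaugeInvariant (fun U => ρ U * f (av.avg U)) :=
  fineGaugeInvariant_mul_comp_avg (fun _ hu U => avg_gaugeAct_of_fineGauge hj av hu U) hρ f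

variable [MeasurableSpace G] [HaarData G] [RegularGaugeGroup G]

/-- **(1.5)⇒(1.6) AGAINST A TEST FUNCTION OF THE COARSE FIELD** (p28 §1 at `F = ρ·(f∘Ū)`): for `ρ` fine-gauge-invariant and integrable, `f` bounded measurable,
`∫dU ρ(U) f(Ū) = ∫dU [Π_{y∈Y}Π_{x∈B(y)∖y} (1∕z)χ({|U(y,x)−1|<ε₀})e^{−(1∕α)[1−Re tr U(y,x)]}] ρ(U) f(Ū)`.
[cite: Balaban1988Convergent, (1.5)–(1.6) p.247] -/
theorem integral_fpWeight_mul_mul_comp_avg_eq (hj : j + 1 ≤ P.m + P.K) (cd : ContourData P j G)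
    (hcd : ∀ (y : Site P (j + 1)) (x : Site P j), Measurable fun U : GaugeField P j G => cd.holTo U y x)
    {α ε₀ : ℝ} (hα : 0 < α) (hz : B16ZLower.zNorm G α ε₀ ≠ 0) (Y : Finset (Site P (j + 1)))
    {avg : GaugeField P j G → GaugeField P (j + 1) G} (havg : Measurable avg)
    (havgInv : ∀ u : GaugeTransf P j G, FineGauge u → ∀ U, avg (gaugeAct u U) = avg U)
    {ρ : Density P j G} (hρ : FineGaugeInvariant ρ) (hρi : Integrable ρ (fieldMeasure P j G))
    {f : GaugeField P (j + 1) G → ℝ} (hf : Measurable f) {C : ℝ} (hC : ∀ V, |f V| ≤ C) :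
    ∫ U, ρ U * f (avg U) ∂fieldMeasure P j G =
      ∫ U, ((∏ y ∈ Y, ∏ x ∈ (block y).erase (emb y), (B16ZLower.zNorm G α ε₀)⁻¹ * fpIntegrand α ε₀ (cd.holTo U y x)) * ρ U) *
        f (avg U) ∂fieldMeasure P j G := by
  have hFi : Integrable (fun U => ρ U * f (avg U)) (fieldMeasure P j G) :=
    hρi.mul_bdd (hf.comp havg).aestronglyMeasurable
      (Filter.Eventually.of_forall fun U => by simpa [Real.norm_eq_abs] using hC (avg U))
  rw [integral_eq_integral_weight_mul hj cd hcd hα hz Y (fineGaugeInvariant_mul_comp_avg havgInv hρ f) hFi]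
  refine integral_congr_ae (ae_of_all _ fun U => ?_)
  simp only [mul_assoc]

variable [StandardBorelSpace G]

/-- ★★ **THE FADDEEV–POPOV WEIGHT UNDER THE δ-FUNCTION.**  For an averaging map `Ū` that is measurable, `HaarAC` and invariant under the fine gauge group, a
fine-gauge-invariant integrable density `ρ`, any contour data `U(y,x)` (measurable), any finset `Y` of block centres, `α > 0`, `z(α, ε₀) ≠ 0`:
`∫dU δ(ŪV⁻¹) [Π_{y∈Y}Π_{x∈B(y)∖y}(1∕z)χ e^{−(1∕α)[1−Re tr U(y,x)]}] ρ(U) = ∫dU δ(ŪV⁻¹) ρ(U)` for `dV`-a.e. `V` — [III] p. 247 «We insert it under the integral,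
and we apply the Faddeev-Popov procedure», p. 265 L.10–12 at step `k`, read at the value level of def-T's kernel transport (†).
[cite: Balaban1988Convergent, (1.5)–(1.6) p.247, p.265 L.10–12, (3.1) p.264] -/
theorem kernelTransport_fpWeight_mul_ae_eq (hj : j + 1 ≤ P.m + P.K) (cd : ContourData P j G)
    (hcd : ∀ (y : Site P (j + 1)) (x : Site P j), Measurable fun U : GaugeField P j G => cd.holTo U y x)
    {α ε₀ : ℝ} (hα : 0 < α) (hz : B16ZLower.zNorm G α ε₀ ≠ 0) (Y : Finset (Site P (j + 1)))
    {avg : GaugeField P j G → GaugeField P (j + 1) G} (havg : Measurable avg) (hac : HaarAC avg)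
    (havgInv : ∀ u : GaugeTransf P j G, FineGauge u → ∀ U, avg (gaugeAct u U) = avg U)
    {ρ : Density P j G} (hρ : FineGaugeInvariant ρ) (hρi : Integrable ρ (fieldMeasure P j G)) :
    transportK avg (fun U =>
        (∏ y ∈ Y, ∏ x ∈ (block y).erase (emb y), (B16ZLower.zNorm G α ε₀)⁻¹ * fpIntegrand α ε₀ (cd.holTo U y x)) * ρ U)
      =ᵐ[fieldMeasure P (j + 1) G] transportK avg ρ := by
  refine kernelTransport_ae_eq_of_forall_integral_mul_comp_eq' (fieldMeasure P j G) (fieldMeasure P (j + 1) G) havg hac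
    (integrable_weight_mul _ cd hcd hα ε₀ _ Y hρi) hρi fun f hf hC => ?_
  obtain ⟨C, hC⟩ := hC
  exact (integral_fpWeight_mul_mul_comp_avg_eq hj cd hcd hα hz Y havg havgInv hρ hρi hf hC).symm

omit [StandardBorelSpace G] in
/-- ★ **THE SAME IN `Setup.IsRT` CURRENCY** (kernel-free, no `HaarAC`): `ρ'` is a renormalization transform of the gauge-fixed density
`fpW·ρ` along `Ū` IFF it is one of `ρ` — the two push-forward identities have the same right-hand side by (1.5)⇒(1.6).
[cite: Balaban1988Convergent, (1.5)–(1.6) p.247; Balaban1985Averaging, (10) p.19] -/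
theorem isRT_fpWeight_mul_iff (hj : j + 1 ≤ P.m + P.K) (cd : ContourData P j G)
    (hcd : ∀ (y : Site P (j + 1)) (x : Site P j), Measurable fun U : GaugeField P j G => cd.holTo U y x)
    {α ε₀ : ℝ} (hα : 0 < α) (hz : B16ZLower.zNorm G α ε₀ ≠ 0) (Y : Finset (Site P (j + 1)))
    {avg : GaugeField P j G → GaugeField P (j + 1) G} (havg : Measurable avg)
    (havgInv : ∀ u : GaugeTransf P j G, FineGauge u → ∀ U, avg (gaugeAct u U) = avg U)
    {ρ : Density P j G} (hρ : FineGaugeInvariant ρ) (hρi : Integrable ρ (fieldMeasure P j G)) (ρ' : Density P (j + 1) G) :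
    IsRT avg (fun U =>
        (∏ y ∈ Y, ∏ x ∈ (block y).erase (emb y), (B16ZLower.zNorm G α ε₀)⁻¹ * fpIntegrand α ε₀ (cd.holTo U y x)) * ρ U) ρ'
      ↔ IsRT avg ρ ρ' := by
  refine forall_congr' fun f => forall_congr' fun hf => forall_congr' fun hC => ?_
  obtain ⟨C, hC⟩ := hC
  rw [integral_fpWeight_mul_mul_comp_avg_eq hj cd hcd hα hz Y havg havgInv hρ hρi hf hC]

open Classical in
/-- **THE (1.6) SHAPE OF THE WEIGHT UNDER THE δ-FUNCTION** (p28's `weight_eq`, `z > 0`):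
`∫dU δ(ŪV⁻¹) χ_{Ax}(Y)(U)·exp[−(1∕α)𝐆(Y,U) − (L^d − 1)|Y| log z]·ρ(U) = ∫dU δ(ŪV⁻¹) ρ(U)` for `dV`-a.e. `V`, with `χ_{Ax}(Y) = Π_{y∈Y}Π_{x∈B(y)∖y}χ({|U(y,x) − 1| < ε₀})`
and `𝐆(Y,U) = Σ_{y∈Y}Σ_{x∈B(y)∖y}[1 − Re tr U(y,x)]` (1.7) (`Setup.gaugeFixFn`). [cite: Balaban1988Convergent, (1.6)–(1.7) p.247, (3.1) p.264] -/
theorem kernelTransport_chiAx_mul_expGaugeFix_mul_ae_eq (hj : j + 1 ≤ P.m + P.K) (cd : ContourData P j G)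
    (hcd : ∀ (y : Site P (j + 1)) (x : Site P j), Measurable fun U : GaugeField P j G => cd.holTo U y x)
    {α ε₀ : ℝ} (hα : 0 < α) (hz : 0 < B16ZLower.zNorm G α ε₀) (Y : Finset (Site P (j + 1)))
    {avg : GaugeField P j G → GaugeField P (j + 1) G} (havg : Measurable avg) (hac : HaarAC avg)
    (havgInv : ∀ u : GaugeTransf P j G, FineGauge u → ∀ U, avg (gaugeAct u U) = avg U)
    {ρ : Density P j G} (hρ : FineGaugeInvariant ρ) (hρi : Integrable ρ (fieldMeasure P j G)) :
    transportK avg (fun U =>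
        ((∏ y ∈ Y, ∏ x ∈ (block y).erase (emb y), if dist1 (cd.holTo U y x) < ε₀ then (1 : ℝ) else 0) *
          Real.exp (-(1 / α) * gaugeFixFn cd Y U - ((P.L : ℝ) ^ P.d - 1) * (Y.card : ℝ) * Real.log (B16ZLower.zNorm G α ε₀))) *
          ρ U)
      =ᵐ[fieldMeasure P (j + 1) G] transportK avg ρ := by
  have h := kernelTransport_fpWeight_mul_ae_eq hj cd hcd hα hz.ne' Y havg hac havgInv hρ hρi
  have e : (fun U : GaugeField P j G =>
      (∏ y ∈ Y, ∏ x ∈ (block y).erase (emb y), (B16ZLower.zNorm G α ε₀)⁻¹ * fpIntegrand α ε₀ (cd.holTo U y x)) * ρ U) =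
      fun U => ((∏ y ∈ Y, ∏ x ∈ (block y).erase (emb y), if dist1 (cd.holTo U y x) < ε₀ then (1 : ℝ) else 0) *
          Real.exp (-(1 / α) * gaugeFixFn cd Y U -
            ((P.L : ℝ) ^ P.d - 1) * (Y.card : ℝ) * Real.log (B16ZLower.zNorm G α ε₀))) * ρ U := by
    funext U
    rw [weight_eq hj cd α ε₀ hz Y U]
  rw [e] at h
  exact h

end Soft

/-! ## §3  HARD GAUGE FIXING: a tree gauge inside the blocks under `δ(ŪV⁻¹)`; the fibre integral over the free bonds -/

section Hard

variable {P : Params} {j : ℕ} {G : Type*} [GaugeGroup G] [MeasurableSpace G] [HaarData G] [MeasurableMul G]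
variable [DecidableEq (PBond P j)]

/-- **LAW FORM OF THE TREE GAUGE FOR FINE-GAUGE-INVARIANT OBSERVABLES.**  For a bond set `T` carrying a peeling order `TreeOrder T v r` whose FRESH ENDS ARE
NEVER BLOCK CENTRES and a measurable observable `Φ` (into any measurable space) invariant under the fine gauge group, `Φ` and `Φ ∘ (·)[T := U₀]` have the same
law under `dU` (gen 16's peeling `lintegral_eq_lintegral_fixTo_of_treeOrder` only needs invariance at the fresh ends, which are fine one-site transformations).
[cite: Balaban1987RG1, (0.13) p.254 (bookkeeping); Balaban1988Convergent, (1.6) p.247 (bookkeeping)] -/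
theorem map_eq_map_fixTo_of_fineGaugeInvariant {T : Finset (PBond P j)} {v : PBond P j → Site P j} {r : Site P j → ℕ}
    (hT : TreeOrder T v r) (hv : ∀ b ∈ T, ∀ y : Site P (j + 1), v b ≠ emb y)
    {γ : Type*} [MeasurableSpace γ] {Φ : GaugeField P j G → γ} (hΦ : Measurable Φ)
    (hinv : ∀ u : GaugeTransf P j G, FineGauge u → ∀ U, Φ (gaugeAct u U) = Φ U) (U₀ : GaugeField P j G) :
    (fieldMeasure P j G).map Φ = (fieldMeasure P j G).map (fun U => Φ (fixTo T U₀ U)) := by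
  have hΦ' : Measurable fun U => Φ (fixTo T U₀ U) := hΦ.comp (measurable_fixTo T U₀)
  have hinv' : ∀ b ∈ T, ∀ (g : G) (U : GaugeField P j G), Φ (gaugeAct (siteTransf (v b) g) U) = Φ U :=
    fun b hb g U => hinv _ (fineGauge_siteTransf_of_forall_ne_emb (hv b hb) g) U
  ext A hA
  rw [Measure.map_apply hΦ hA, Measure.map_apply hΦ' hA, ← lintegral_indicator_one (hΦ hA),
    ← lintegral_indicator_one (hΦ' hA)]
  have hind : Measurable fun U => (A.indicator (1 : γ → ℝ≥0∞)) (Φ U) := (measurable_one.indicator hA).comp hΦ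
  have key := lintegral_eq_lintegral_fixTo_of_treeOrder hT hind
    (fun b hb g U => by simp only [hinv' b hb g U]) U₀
  have e1 : ∀ U, (Φ ⁻¹' A).indicator (1 : GaugeField P j G → ℝ≥0∞) U = A.indicator 1 (Φ U) := fun U => by
    simpa only [Pi.one_comp] using Set.indicator_comp_right Φ (s := A) (g := (1 : γ → ℝ≥0∞)) (x := U)
  have e2 : ∀ U, ((fun U => Φ (fixTo T U₀ U)) ⁻¹' A).indicator (1 : GaugeField P j G → ℝ≥0∞) U =
      A.indicator 1 (Φ (fixTo T U₀ U)) := fun U => by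
    simpa only [Pi.one_comp] using
      Set.indicator_comp_right (fun U => Φ (fixTo T U₀ U)) (s := A) (g := (1 : γ → ℝ≥0∞)) (x := U)
  calc ∫⁻ U, (Φ ⁻¹' A).indicator 1 U ∂fieldMeasure P j G
      = ∫⁻ U, A.indicator 1 (Φ U) ∂fieldMeasure P j G := lintegral_congr e1
    _ = ∫⁻ U, A.indicator 1 (Φ (fixTo T U₀ U)) ∂fieldMeasure P j G := key
    _ = ∫⁻ U, ((fun U => Φ (fixTo T U₀ U)) ⁻¹' A).indicator 1 U ∂fieldMeasure P j G := (lintegral_congr e2).symm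

/-- **THE COARSE LAW IS NOT MOVED BY THE TREE GAUGE**: `Ū_*(dU) = (Ū ∘ (·)[T := U₀])_*(dU) = (Ū ∘ glue T U₀)_*(∏_{b∉T} dU(b))` for an averaging invariant under
the fine gauge group. [cite: Balaban1987RG1, (0.13) p.254 (bookkeeping); Balaban1988Convergent, (3.1) p.264 (bookkeeping)] -/
theorem map_avg_eq_map_avg_glue_freeMeasure {T : Finset (PBond P j)} {v : PBond P j → Site P j} {r : Site P j → ℕ}
    (hT : TreeOrder T v r) (hv : ∀ b ∈ T, ∀ y : Site P (j + 1), v b ≠ emb y)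
    {avg : GaugeField P j G → GaugeField P (j + 1) G} (havg : Measurable avg)
    (havgInv : ∀ u : GaugeTransf P j G, FineGauge u → ∀ U, avg (gaugeAct u U) = avg U) (U₀ : GaugeField P j G) :
    (fieldMeasure P j G).map avg = (freeMeasure T).map (fun W => avg (glue T U₀ W)) := by
  have e1 : (fun U => avg (fixTo T U₀ U)) = avg ∘ fixTo T U₀ := rfl
  rw [map_eq_map_fixTo_of_fineGaugeInvariant hT hv havg havgInv U₀, e1,
    ← Measure.map_map havg (measurable_fixTo T U₀), map_fixTo_eq_map_glue, Measure.map_map havg (measurable_glue T U₀)]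
  rfl

/-- **THE PAIRING IN THE TREE GAUGE**: `∫dU ρ(U) f(Ū) = ∫dU ρ(U[T := U₀]) f(Ū(U[T := U₀]))` for fine-gauge-invariant measurable `ρ`, measurable `f`
(integrable or not), any tree whose fresh ends avoid the centres. [cite: Balaban1988Convergent, (3.1) p.264 (bookkeeping); Balaban1987RG1, (0.13) p.254 (bookkeeping)] -/
theorem integral_mul_comp_avg_eq_integral_fixTo {T : Finset (PBond P j)} {v : PBond P j → Site P j} {r : Site P j → ℕ}
    (hT : TreeOrder T v r) (hv : ∀ b ∈ T, ∀ y : Site P (j + 1), v b ≠ emb y)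
    {avg : GaugeField P j G → GaugeField P (j + 1) G} (havg : Measurable avg)
    (havgInv : ∀ u : GaugeTransf P j G, FineGauge u → ∀ U, avg (gaugeAct u U) = avg U)
    {ρ : Density P j G} (hρm : Measurable ρ) (hρ : FineGaugeInvariant ρ)
    {f : GaugeField P (j + 1) G → ℝ} (hf : Measurable f) (U₀ : GaugeField P j G) :
    ∫ U, ρ U * f (avg U) ∂fieldMeasure P j G = ∫ U, ρ (fixTo T U₀ U) * f (avg (fixTo T U₀ U)) ∂fieldMeasure P j G := by
  have hΦ : Measurable fun U : GaugeField P j G => ρ U * f (avg U) := hρm.mul (hf.comp havg)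
  have hΦ' : Measurable fun U : GaugeField P j G => ρ (fixTo T U₀ U) * f (avg (fixTo T U₀ U)) :=
    hΦ.comp (measurable_fixTo T U₀)
  have hlaw := map_eq_map_fixTo_of_fineGaugeInvariant hT hv hΦ (fineGaugeInvariant_mul_comp_avg havgInv hρ f) U₀
  have h1 : ∫ U, ρ U * f (avg U) ∂fieldMeasure P j G = ∫ t, t ∂(fieldMeasure P j G).map (fun U => ρ U * f (avg U)) :=
    (integral_map hΦ.aemeasurable aestronglyMeasurable_id).symm
  have h2 : ∫ U, ρ (fixTo T U₀ U) * f (avg (fixTo T U₀ U)) ∂fieldMeasure P j G =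
      ∫ t, t ∂(fieldMeasure P j G).map (fun U => ρ (fixTo T U₀ U) * f (avg (fixTo T U₀ U))) :=
    (integral_map hΦ'.aemeasurable aestronglyMeasurable_id).symm
  rw [h1, h2, hlaw]

/-- **THE PAIRING OVER THE FREE BONDS**: `∫dU ρ(U) f(Ū) = ∫ ∏_{b∉T} dU(b) ρ(U₀ on T, W off T) f(Ū(U₀ on T, W off T))` — the textbook reduced integral of gen 16, with
the test function of the coarse field carried along. [cite: Balaban1988Convergent, (3.1) p.264 (bookkeeping); Balaban1987RG1, (0.13) p.254 (bookkeeping)] -/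
theorem integral_mul_comp_avg_eq_integral_freeMeasure_glue {T : Finset (PBond P j)} {v : PBond P j → Site P j}
    {r : Site P j → ℕ} (hT : TreeOrder T v r) (hv : ∀ b ∈ T, ∀ y : Site P (j + 1), v b ≠ emb y)
    {avg : GaugeField P j G → GaugeField P (j + 1) G} (havg : Measurable avg)
    (havgInv : ∀ u : GaugeTransf P j G, FineGauge u → ∀ U, avg (gaugeAct u U) = avg U)
    {ρ : Density P j G} (hρm : Measurable ρ) (hρ : FineGaugeInvariant ρ)
    {f : GaugeField P (j + 1) G → ℝ} (hf : Measurable f) (U₀ : GaugeField P j G) :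
    ∫ U, ρ U * f (avg U) ∂fieldMeasure P j G = ∫ W, ρ (glue T U₀ W) * f (avg (glue T U₀ W)) ∂freeMeasure T := by
  rw [integral_mul_comp_avg_eq_integral_fixTo hT hv havg havgInv hρm hρ hf U₀]
  exact T4TreeGaugeFixing.integral_fixTo_eq_integral_glue T U₀ (F := fun U => ρ U * f (avg U)) (hρm.mul (hf.comp havg))

/-- An integrable fine-gauge-invariant measurable density stays integrable when read on the free bonds of a tree whose fresh ends avoid the centres:
`W ↦ ρ(U₀ on T, W off T)` is `∏_{b∉T} dU(b)`-integrable (the law of `ρ` is unchanged by the tree gauge). [cite: Balaban1988Convergent, (3.1) p.264 (bookkeeping)] -/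
theorem integrable_comp_glue_freeMeasure {T : Finset (PBond P j)} {v : PBond P j → Site P j} {r : Site P j → ℕ}
    (hT : TreeOrder T v r) (hv : ∀ b ∈ T, ∀ y : Site P (j + 1), v b ≠ emb y)
    {ρ : Density P j G} (hρm : Measurable ρ) (hρ : FineGaugeInvariant ρ) (hρi : Integrable ρ (fieldMeasure P j G))
    (U₀ : GaugeField P j G) :
    Integrable (fun W => ρ (glue T U₀ W)) (freeMeasure (G := G) T) := by
  -- the law of `ρ ∘ glue` under the reduced measure is the law of `ρ ∘ fixTo` under `dU`, which is the law of `ρ`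
  have hlaw : (fieldMeasure P j G).map ρ = (freeMeasure T).map (fun W => ρ (glue T U₀ W)) := by
    have e1 : (fun U => ρ (fixTo T U₀ U)) = ρ ∘ fixTo T U₀ := rfl
    rw [map_eq_map_fixTo_of_fineGaugeInvariant hT hv hρm hρ U₀, e1,
      ← Measure.map_map hρm (measurable_fixTo T U₀), map_fixTo_eq_map_glue, Measure.map_map hρm (measurable_glue T U₀)]
    rfl
  have h1 : Integrable (fun t : ℝ => t) ((fieldMeasure P j G).map ρ) :=
    (integrable_map_measure aestronglyMeasurable_id hρm.aemeasurable).2 hρi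
  rw [hlaw] at h1
  exact (integrable_map_measure aestronglyMeasurable_id (hρm.comp (measurable_glue T U₀)).aemeasurable).1 h1

variable [StandardBorelSpace G]

/-- ★★ **THE TREE GAUGE UNDER THE δ-FUNCTION.**  For an averaging map `Ū` that is measurable, `HaarAC` and invariant under the fine gauge group, a tree `T`
whose peeling order has no fresh end at a block centre, a fine-gauge-invariant integrable measurable density `ρ` and ANY prescribed values `U₀` on `T`:
`∫dU δ(ŪV⁻¹) ρ(U) = ∫ ∏_{b∉T} dU(b) δ(Ū(U₀ on T, W off T) V⁻¹) ρ(U₀ on T, W off T)` for `dV`-a.e. `V` — the fibre integral of def-T's (†) runs over the FREE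
bonds only (kernel transport of `ρ ∘ glue` from the reduced carrier `(Free T → G, ∏ dU(b))` along `Ū ∘ glue`).
[cite: Balaban1988Convergent, (3.1) p.264, (1.6) p.247 (bookkeeping); Balaban1987RG1, (0.13)–(0.16) pp.254–255 (bookkeeping)] -/
theorem kernelTransport_ae_eq_kernelTransport_freeMeasure_glue {T : Finset (PBond P j)} {v : PBond P j → Site P j}
    {r : Site P j → ℕ} (hT : TreeOrder T v r) (hv : ∀ b ∈ T, ∀ y : Site P (j + 1), v b ≠ emb y)
    {avg : GaugeField P j G → GaugeField P (j + 1) G} (havg : Measurable avg) (hac : HaarAC avg)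
    (havgInv : ∀ u : GaugeTransf P j G, FineGauge u → ∀ U, avg (gaugeAct u U) = avg U)
    {ρ : Density P j G} (hρm : Measurable ρ) (hρ : FineGaugeInvariant ρ) (hρi : Integrable ρ (fieldMeasure P j G))
    (U₀ : GaugeField P j G) :
    transportK avg ρ =ᵐ[fieldMeasure P (j + 1) G]
      kernelTransport (freeMeasure T) (fieldMeasure P (j + 1) G) (fun W => avg (glue T U₀ W)) (fun W => ρ (glue T U₀ W)) := by
  have hmeas : Measurable fun W : Free T → G => avg (glue T U₀ W) := havg.comp (measurable_glue T U₀)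
  have hac' : (freeMeasure T).map (fun W : Free T → G => avg (glue T U₀ W)) ≪ fieldMeasure P (j + 1) G := by
    rw [← map_avg_eq_map_avg_glue_freeMeasure hT hv havg havgInv U₀]; exact hac
  refine kernelTransport_ae_eq_of_forall_integral_mul_comp_eq (fieldMeasure P j G) (freeMeasure T) (fieldMeasure P (j + 1) G)
    havg hac hmeas hac' hρi (integrable_comp_glue_freeMeasure hT hv hρm hρ hρi U₀) fun f hf _ => ?_
  exact integral_mul_comp_avg_eq_integral_freeMeasure_glue hT hv havg havgInv hρm hρ hf U₀

end Hard

/-! ## §4  AT THE RECORD: `G = SU(N)`, the torus `F.P K`, the averaging `avOfRecord F N K k` and the transport `transportOfRecord F N K k` of def-T,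
the contour variables `contourOfRecord F N K k` ((0.11) with Federbush's inner mean) -/

section Record

variable (F : T4Family) (N : ℕ) [NeZero N]

/-- The standing range `k + 1 ≤ m + K` of the `K`-th torus from `k < K` (bookkeeping; the Summits-side twin is dag-n09's
`…N09LiftInvariance29AtRecord.succ_le_range_of_lt`, not importable here). [folklore] -/
private theorem succ_le_m_add_K_of_lt {K k : ℕ} (hk : k < K) : k + 1 ≤ (F.P K).m + (F.P K).K := by
  simp only [T4Family.P_K, T4Family.P_m]; omega

/-- The averaging of record is invariant under the fine gauge group (`Setup.Averaging.covariant` + `u(emb y) = 1`). [cite: Balaban1987RG1, (0.4) p.253, (0.13) p.254] -/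
theorem avOfRecord_gaugeAct_of_fineGauge {K k : ℕ} (hk : k < K) {u : GaugeTransf (F.P K) k (SU N)} (hu : FineGauge u)
    (U : GaugeField (F.P K) k (SU N)) : (avOfRecord F N K k).avg (gaugeAct u U) = (avOfRecord F N K k).avg U :=
  avg_gaugeAct_of_fineGauge (succ_le_m_add_K_of_lt F hk) (avOfRecord F N K k) hu U

/-- The contour variables of record are measurable functions of the fine field (`…TwoLevel.measurable_holTo` at Federbush's mean, `federbushSU_measurable`).
[cite: Balaban1987RG1, (0.11) p.253 (kernel property, by name)] -/
theorem measurable_holTo_contourOfRecord (K k : ℕ) (y : Site (F.P K) (k + 1)) (x : Site (F.P K) k) :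
    Measurable fun U : GaugeField (F.P K) k (SU N) => (contourOfRecord F N K k).holTo U y x :=
  B12FaddeevPopov016TwoLevel.measurable_holTo _ (FederbushMean.federbushSU_measurable (n := Fin N)) y x

/-- ★★★ **THE FADDEEV–POPOV WEIGHT UNDER THE δ-FUNCTION OF THE TRANSPORT OF RECORD** ([III] p. 265 L.10–12 «we introduce the axial gauge fixing as in (1.5), with
V_k, ε_k, g_k … We get an expansion of the form (1.6)», at the value level of def-T's (†)): for `k < K`, any finset `Y` of centres of `T^{(k+1)}`, `α > 0` (print:
`g_k²`), `ε₀ > 0` (print: `ε_k`), and a fine-gauge-invariant integrable density `ρ`,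
`transportOfRecord k ([Π_{y∈Y}Π_{x∈B(y)∖y}(1∕z)χ({|U(y,x)−1|<ε₀})e^{−(1∕α)[1−Re tr U(y,x)]}]·ρ) = transportOfRecord k ρ`  `dV`-a.e.
[cite: Balaban1988Convergent, (1.5)–(1.6) p.247, p.265 L.10–12, (3.1) p.264] -/
theorem transportOfRecord_fpWeight_mul_ae_eq {K k : ℕ} (hk : k < K) {α ε₀ : ℝ} (hα : 0 < α) (hε : 0 < ε₀)
    (Y : Finset (Site (F.P K) (k + 1))) {ρ : Density (F.P K) k (SU N)} (hρ : FineGaugeInvariant ρ)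
    (hρi : Integrable ρ (fieldMeasure (F.P K) k (SU N))) :
    transportOfRecord F N K k (fun U =>
        (∏ y ∈ Y, ∏ x ∈ (block y).erase (emb y),
          (B16ZLower.zNorm (SU N) α ε₀)⁻¹ * fpIntegrand α ε₀ ((contourOfRecord F N K k).holTo U y x)) * ρ U)
      =ᵐ[fieldMeasure (F.P K) (k + 1) (SU N)] transportOfRecord F N K k ρ :=
  kernelTransport_fpWeight_mul_ae_eq (succ_le_m_add_K_of_lt F hk) (contourOfRecord F N K k) (measurable_holTo_contourOfRecord F N K k) hα
    (B12FaddeevPopov016TwoLevel.zNorm_specialUnitaryGroup_pos hα hε).ne' Y (avOfRecord_measurable F N K k) (avOfRecord_haarAC F N K k hk)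
    (fun _ hu U => avOfRecord_gaugeAct_of_fineGauge F N hk hu U) hρ hρi

/-- ★ **`Setup.IsRT` CURRENCY AT THE RECORD** (no `HaarAC`, every `k` of the standing range): along `avOfRecord`, `ρ'` is a renormalization transform of the
gauge-fixed density IFF of `ρ`. [cite: Balaban1988Convergent, (1.5)–(1.6) p.247; Balaban1985Averaging, (10) p.19] -/
theorem isRT_avOfRecord_fpWeight_mul_iff {K k : ℕ} (hk : k < K) {α ε₀ : ℝ} (hα : 0 < α) (hε : 0 < ε₀)
    (Y : Finset (Site (F.P K) (k + 1))) {ρ : Density (F.P K) k (SU N)} (hρ : FineGaugeInvariant ρ)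
    (hρi : Integrable ρ (fieldMeasure (F.P K) k (SU N))) (ρ' : Density (F.P K) (k + 1) (SU N)) :
    IsRT (avOfRecord F N K k).avg (fun U =>
        (∏ y ∈ Y, ∏ x ∈ (block y).erase (emb y),
          (B16ZLower.zNorm (SU N) α ε₀)⁻¹ * fpIntegrand α ε₀ ((contourOfRecord F N K k).holTo U y x)) * ρ U) ρ'
      ↔ IsRT (avOfRecord F N K k).avg ρ ρ' :=
  isRT_fpWeight_mul_iff (succ_le_m_add_K_of_lt F hk) (contourOfRecord F N K k) (measurable_holTo_contourOfRecord F N K k) hα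
    (B12FaddeevPopov016TwoLevel.zNorm_specialUnitaryGroup_pos hα hε).ne' Y (avOfRecord_measurable F N K k)
    (fun _ hu U => avOfRecord_gaugeAct_of_fineGauge F N hk hu U) hρ hρi ρ'

open Classical in
/-- **THE (1.6) SHAPE AT THE RECORD**: `transportOfRecord k (χ_{Ax}(Y)·exp[−(1∕α)𝐆(Y,·) − (L^d − 1)|Y| log z]·ρ) = transportOfRecord k ρ` `dV`-a.e., `𝐆` = (1.7) on the
contour variables of record. [cite: Balaban1988Convergent, (1.6)–(1.7) p.247, p.265 L.10–12, (3.1) p.264] -/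
theorem transportOfRecord_chiAx_mul_exp_gaugeFixFn_mul_ae_eq {K k : ℕ} (hk : k < K) {α ε₀ : ℝ} (hα : 0 < α) (hε : 0 < ε₀)
    (Y : Finset (Site (F.P K) (k + 1))) {ρ : Density (F.P K) k (SU N)} (hρ : FineGaugeInvariant ρ)
    (hρi : Integrable ρ (fieldMeasure (F.P K) k (SU N))) :
    transportOfRecord F N K k (fun U =>
        ((∏ y ∈ Y, ∏ x ∈ (block y).erase (emb y), if dist1 ((contourOfRecord F N K k).holTo U y x) < ε₀ then (1 : ℝ) else 0) *
          Real.exp (-(1 / α) * gaugeFixFn (contourOfRecord F N K k) Y U -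
            (((F.P K).L : ℝ) ^ (F.P K).d - 1) * (Y.card : ℝ) * Real.log (B16ZLower.zNorm (SU N) α ε₀))) * ρ U)
      =ᵐ[fieldMeasure (F.P K) (k + 1) (SU N)] transportOfRecord F N K k ρ :=
  kernelTransport_chiAx_mul_expGaugeFix_mul_ae_eq (succ_le_m_add_K_of_lt F hk) (contourOfRecord F N K k)
    (measurable_holTo_contourOfRecord F N K k) hα (B12FaddeevPopov016TwoLevel.zNorm_specialUnitaryGroup_pos hα hε) Y
    (avOfRecord_measurable F N K k) (avOfRecord_haarAC F N K k hk) (fun _ hu U => avOfRecord_gaugeAct_of_fineGauge F N hk hu U) hρ hρi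

open Classical in
/-- At `Y = univ` (ALL blocks gauge-fixed, [I] (0.16)∕(0.19)) the exponent is node00's gauge-fixing term of record `gfOfRecord F N K k` (`BackgroundActionOfRecord`):
`transportOfRecord k (χ_{Ax}·exp[−(1∕α) gfOfRecord − (L^d − 1)|T^{(k+1)}| log z]·ρ) = transportOfRecord k ρ` `dV`-a.e. [cite: Balaban1987RG1, (0.16) p.255, (0.19) p.255; Balaban1988Convergent, (3.1) p.264] -/
theorem transportOfRecord_chiAx_mul_exp_gfOfRecord_mul_ae_eq {K k : ℕ} (hk : k < K) {α ε₀ : ℝ} (hα : 0 < α) (hε : 0 < ε₀)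
    {ρ : Density (F.P K) k (SU N)} (hρ : FineGaugeInvariant ρ) (hρi : Integrable ρ (fieldMeasure (F.P K) k (SU N))) :
    transportOfRecord F N K k (fun U =>
        ((∏ y : Site (F.P K) (k + 1), ∏ x ∈ (block y).erase (emb y),
            if dist1 ((contourOfRecord F N K k).holTo U y x) < ε₀ then (1 : ℝ) else 0) *
          Real.exp (-(1 / α) * gfOfRecord F N K k U -
            (((F.P K).L : ℝ) ^ (F.P K).d - 1) * (Fintype.card (Site (F.P K) (k + 1)) : ℝ) *
              Real.log (B16ZLower.zNorm (SU N) α ε₀))) * ρ U)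
      =ᵐ[fieldMeasure (F.P K) (k + 1) (SU N)] transportOfRecord F N K k ρ := by
  have h := transportOfRecord_chiAx_mul_exp_gaugeFixFn_mul_ae_eq F N hk hα hε Finset.univ hρ hρi
  simp only [Finset.card_univ] at h
  exact h

/-- ★★ **THE TREE GAUGE UNDER THE δ-FUNCTION OF THE TRANSPORT OF RECORD**: for `k < K`, a bond set `T` of `T^{(k)}` with a peeling order whose fresh ends avoid the
centres `emb y`, a fine-gauge-invariant integrable measurable `ρ` and any `U₀`:
`transportOfRecord k ρ = kernelTransport (∏_{b∉T} dU(b)) dV (Ū ∘ glue T U₀) (ρ ∘ glue T U₀)` `dV`-a.e. — def-T's fibre integral over the free bonds only.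
[cite: Balaban1988Convergent, (3.1) p.264, (1.6) p.247 (bookkeeping); Balaban1987RG1, (0.13)–(0.16) pp.254–255 (bookkeeping)] -/
theorem transportOfRecord_ae_eq_kernelTransport_freeMeasure_glue {K k : ℕ} (hk : k < K) [DecidableEq (PBond (F.P K) k)]
    {T : Finset (PBond (F.P K) k)} {v : PBond (F.P K) k → Site (F.P K) k} {r : Site (F.P K) k → ℕ}
    (hT : TreeOrder T v r) (hv : ∀ b ∈ T, ∀ y : Site (F.P K) (k + 1), v b ≠ emb y)
    {ρ : Density (F.P K) k (SU N)} (hρm : Measurable ρ) (hρ : FineGaugeInvariant ρ)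
    (hρi : Integrable ρ (fieldMeasure (F.P K) k (SU N))) (U₀ : GaugeField (F.P K) k (SU N)) :
    transportOfRecord F N K k ρ =ᵐ[fieldMeasure (F.P K) (k + 1) (SU N)]
      kernelTransport (freeMeasure T) (fieldMeasure (F.P K) (k + 1) (SU N))
        (fun W => (avOfRecord F N K k).avg (glue T U₀ W)) (fun W => ρ (glue T U₀ W)) :=
  kernelTransport_ae_eq_kernelTransport_freeMeasure_glue hT hv (avOfRecord_measurable F N K k) (avOfRecord_haarAC F N K k hk)
    (fun _ hu U => avOfRecord_gaugeAct_of_fineGauge F N hk hu U) hρm hρ hρi U₀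

end Record

end Literature.MathematicalPhysics.QuantumFieldTheory.Balaban1983to89.Node00

end
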